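import Literature.NumberTheory.EllipticCurves.ClassPolynomialNegFifteen
import HarnessLib

/-!
# The class polynomial of discriminant `−60`: `H_{−60}(X) = X² − 37018076625·X + 153173312762625`,
# and `j(√−15) = (37018076625 + 16554983445√5)/2`, `j(τ_{(3,0,5)}) = (37018076625 − 16554983445√5)/2`

Topic `NumberTheory/EllipticCurves` (singular moduli); theorem-only sequel (no definition, no named fact)
of `ClassPolynomialNegFifteen.lean`.  The order `𝒪_{−60} = ℤ[√−15]` (conductor `2` in `ℚ(√−15)`) has
class number two, reduced forms `(1,0,15)`, `(3,0,5)` (Cox Thm. 2.13), and its class polynomial and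
singular moduli are PRINTED in N. Ishii, *Trace of Frobenius endomorphism of an elliptic curve with
complex multiplication*, Bull. Austral. Math. Soc. 70 (2004) 125–142, §3, table "the case `h(R) = 2`"
(class equations prepared by M. Kaneko), row `d(R) = −60`:
`x² − 37018076625x + 153173312762625`, `j = (37018076625 + 16554983445√5)/2`; the same table prints the
row `d(R) = −15`: `H₁₅(x) = x² + 191025x − 121287375`, `j_2 = (−191025 − 85995√5)/2` of the previous file.

## Method — the THIRD root of the two level-2 fibres of `ClassPolynomialNegFifteen.lean`

With `τ₁ = τ_{(1,1,4)}`, `τ₂ = τ_{(2,1,2)}`, `j₁ = j(τ₁)`, `j₂ = j(τ₂)` (the two singular moduli of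
discriminant `−15`):

* the fibre of `Φ₂` over `j₁` is `(x − j(2τ₁))·(x − j₂)²` (`fiber_formJ_one_one_four`) and, because
  `H_{−15}(j₁) = 0`, also `(x + 191025 + j₁)²·(x − 121831425 + 192511·j₁)` (`fiber_eq_of_root`);
  comparing the simple roots gives **`j(2τ₁) = 121831425 − 192511·j₁`**, and `2τ₁ = τ_{(1,2,16)} ∼ τ_{(1,0,15)}`,
  i.e. `j(√−15) = 121831425 − 192511·j₁ = (37018076625 + 16554983445√5)/2`;
* the fibre over `j₂` is `(x − j(2τ₂))(x − j(τ₂/2))(x − j((τ₂+1)/2)) = (x − j₁)(x − j₁)(x − j(τ_{(3,0,5)}))`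
  (`2τ₂ = τ_{(2,2,8)} = τ₁`; `τ₂/2 = τ_{(8,2,2)} = τ_{(4,1,1)} ∼ τ_{(1,−1,4)} ∼ τ₁`;
  `(τ₂+1)/2 = τ_{(8,−6,3)} ∼ τ_{(3,0,5)}`), and `H_{−15}(j₂) = 0` factors it as
  `(x + 191025 + j₂)²(x − 121831425 + 192511·j₂)`, whence **`j(τ_{(3,0,5)}) = 121831425 − 192511·j₂`**;
* `H_{−60} = (X − j(τ_{(1,0,15)}))(X − j(τ_{(3,0,5)}))` has trace `2·121831425 + 192511·191025 = 37018076625`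
  and norm `121831425² + 121831425·192511·191025 − 192511²·121287375 = 153173312762625 = 53505³`;
  `H_{−60}(1728) = 9444897² = (3³·7²·11²·59)²`.

## References

* [Ishii2004] N. Ishii, Bull. Austral. Math. Soc. 70 (2004) 125–142 (= arXiv:math/0401289), §3 table
  (rows `−15`, `−60`).
* [Morton2014] P. Morton, Funct. Approx. Comment. Math. 51 (2014), p. 84.
* [Cox2013] D. A. Cox, *Primes of the form x² + ny²*, 2nd ed., Thm. 2.13, §11.B (11.14)–(11.15),
  Thm. 11.2, §13.A Prop. 13.2.
-/

noncomputable section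

open Complex Polynomial
open UpperHalfPlane hiding I

namespace Literature.NumberTheory.EllipticCurves

open ModularForms ModularPolynomialTwo ClassPolynomialNegFifteen
open Literature.NumberTheory.QuadraticFields.BinaryQuadraticForm (reducedForms principalForm)
open Literature.NumberTheory.QuadraticFields.Quadratic (BinQF)

namespace ClassPolynomialNegSixty

/-! ### §1 The simple root of a cubic with a marked double root -/

/-- If `(x − β)(x − A)² = (x − A)²(x − B)` for all `x ∈ ℂ` then `β = B` (evaluate at `x = A + 1`). [folklore] -/
private theorem eq_of_cubic_eq_simple {β A B : ℂ} (h : ∀ x : ℂ, (x - β) * ((x - A) * (x - A)) = (x - A) * (x - A) * (x - B)) :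
    β = B := by
  have h1 := h (A + 1)
  simp only [add_sub_cancel_left, mul_one, one_mul] at h1
  linear_combination -h1

/-! ### §2 `j(√−15)`: the simple root of the fibre over `j₁` -/

/-- `2τ₁ = τ_{(1,2,16)}` and `j(τ_{(1,2,16)}) = j(τ_{(1,0,15)}) = j(√−15)`. [cite: Cox2013, §11.A Thm. 11.2] -/
theorem kleinJ_mulPoint_two_heegnerTau_one_one_four :
    kleinJ (mulPoint 2 (heegnerTau (1, 1, 4))) = formJ (1, 0, 15) := by
  have h := mulPoint_two_heegnerTau (a := 1) (b := 1) (c := 4) one_pos (by norm_num)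
  norm_num at h
  rw [h, ← formJ_eq_kleinJ, formJ_one_eq_of_discr_eq (B := 2) (C := 16) (B' := 0) (C' := 15)
    (by norm_num) (by norm_num)]

/-- **`j(√−15) = 121831425 − 192511·j((−1+√−15)/2)`** — the simple root of the fibre of `Φ₂` over `j₁`.
[cite: Morton2014, p. 84] -/
theorem formJ_one_zero_fifteen_eq_sub : formJ (1, 0, 15) = 121831425 - 192511 * formJ (1, 1, 4) := by
  refine eq_of_cubic_eq_simple (A := -191025 - formJ (1, 1, 4)) fun x => ?_
  have h1 := fiber_formJ_one_one_four x
  rw [kleinJ_mulPoint_two_heegnerTau_one_one_four, formJ_two_one_two_eq_neg_sub] at h1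
  rw [← h1, fiber_eq_of_root formJ_one_one_four_isRoot x]

/-- **`j(√−15) = (37018076625 + 16554983445√5)/2`** (Ishii's table, row `d(R) = −60`).
[cite: Ishii2004, §3 table (row d(R) = −60)] -/
theorem formJ_one_zero_fifteen_eq :
    formJ (1, 0, 15) = (37018076625 + 16554983445 * (√(5 : ℝ) : ℂ)) / 2 := by
  rw [formJ_one_zero_fifteen_eq_sub, formJ_one_one_four_eq]
  ring

/-- `j(𝒪_{−60}) = j(ℤ[√−15]) = (37018076625 + 16554983445√5)/2` for the tree's lattice `cmPeriodPair (−60)`.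
[cite: Ishii2004, §3 table (row d(R) = −60)] -/
theorem j_cmPeriodPair_neg_sixty :
    (cmPeriodPair (-60)).j = (37018076625 + 16554983445 * (√(5 : ℝ) : ℂ)) / 2 := by
  have hP : principalForm (-60) = ((1 : ℤ), (0 : ℤ), (15 : ℤ)) := by decide
  rw [← formJ_principalForm (D := -60) (by norm_num) (by norm_num), hP, formJ_one_zero_fifteen_eq]

/-! ### §3 `j(τ_{(3,0,5)})`: the simple root of the fibre over `j₂` -/

/-- `2τ₂ = τ_{(2,2,8)} = τ₁` for `τ₂ = τ_{(2,1,2)}`. [cite: Cox2013, §11.B (11.14)–(11.15)] -/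
theorem mulPoint_two_heegnerTau_two_one_two : mulPoint 2 (heegnerTau (2, 1, 2)) = heegnerTau (1, 1, 4) := by
  apply UpperHalfPlane.ext
  rw [coe_mulPoint, coe_heegnerTau_eq (Q := ((2 : ℤ), (1 : ℤ), (2 : ℤ))) (D := -15) (by norm_num) (by norm_num)
      (by norm_num),
    coe_heegnerTau_eq (Q := ((1 : ℤ), (1 : ℤ), (4 : ℤ))) (D := -15) (by norm_num) (by norm_num) (by norm_num)]
  push_cast
  ring

/-- `τ₂/2 = τ_{(8,2,2)} = τ_{(4,1,1)}`. [cite: Cox2013, §11.B (11.14)–(11.15)] -/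
theorem divPoint_two_zero_heegnerTau_two_one_two :
    divPoint 2 0 (heegnerTau (2, 1, 2)) = heegnerTau (4, 1, 1) := by
  have h := divPoint_two_zero_heegnerTau (a := 2) (b := 1) (c := 2) (by norm_num) (by norm_num)
  norm_num at h
  rw [h]
  apply UpperHalfPlane.ext
  rw [coe_heegnerTau_eq (Q := ((8 : ℤ), (2 : ℤ), (2 : ℤ))) (D := 4 * (-15)) (by norm_num) (by norm_num)
      (by norm_num),
    coe_heegnerTau_eq (Q := ((4 : ℤ), (1 : ℤ), (1 : ℤ))) (D := -15) (by norm_num) (by norm_num) (by norm_num),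
    sqrtDisc_four_mul]
  push_cast
  ring

/-- `(τ₂ + 1)/2 = τ_{(8,−6,3)}`. [cite: Cox2013, §11.B (11.14)–(11.15)] -/
theorem divPoint_two_one_heegnerTau_two_one_two :
    divPoint 2 1 (heegnerTau (2, 1, 2)) = heegnerTau (8, -6, 3) := by
  have h := divPoint_two_heegnerTau (a := 2) (b := 1) (c := 2) (by norm_num) (by norm_num) 1
  norm_num at h
  exact h

/-- `j(τ_{(4,1,1)}) = j(τ_{(1,−1,4)}) = j(τ_{(1,1,4)})`. [cite: Cox2013, §11.A Thm. 11.2] -/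
theorem formJ_four_one_one : formJ (4, 1, 1) = formJ (1, 1, 4) := by
  rw [formJ_eq_formJ_flip (a := 4) (b := 1) (c := 1) (by norm_num) (by norm_num)]
  exact formJ_one_eq_of_discr_eq (B := -1) (C := 4) (B' := 1) (C' := 4) (by norm_num) (by norm_num)

/-- `j(τ_{(8,−6,3)}) = j(τ_{(3,0,5)})`: `(8,−6,3)·γ = (3,0,5)` for `γ = (0 −1; 1 −1) ∈ SL₂(ℤ)`.
[cite: Cox2013, §11.A Thm. 11.2 and Exercise 11.5] -/
theorem formJ_eight_neg_six_three : formJ (8, -6, 3) = formJ (3, 0, 5) := by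
  have h := formJ_eq_formJ_act ⟨8, -6, 3⟩ (by norm_num) (by norm_num [BinQF.disc]) (p := 0) (q := -1) (r := 1)
    (s := -1) (by norm_num)
  simpa [BinQF.act] using h

/-- **The fibre of `Φ₂` over `j₂ = j(τ_{(2,1,2)})`**: `Φ₂(x, j₂) = (x − j₁)·((x − j₁)(x − j(τ_{(3,0,5)})))`.
[cite: Cox2013, §11.B (11.14)–(11.15)] -/
theorem fiber_formJ_two_one_two (x : ℂ) :
    x ^ 3 + formJ (2, 1, 2) ^ 3 - x ^ 2 * formJ (2, 1, 2) ^ 2 +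
        1488 * (x ^ 2 * formJ (2, 1, 2) + x * formJ (2, 1, 2) ^ 2) - 162000 * (x ^ 2 + formJ (2, 1, 2) ^ 2) +
        40773375 * x * formJ (2, 1, 2) + 8748000000 * (x + formJ (2, 1, 2)) - 157464000000000 =
      (x - formJ (1, 1, 4)) * ((x - formJ (1, 1, 4)) * (x - formJ (3, 0, 5))) := by
  have h := eval_kleinJ_eq_prod x (heegnerTau (2, 1, 2))
  rw [intModularPolynomial_two_eval, mulPoint_two_heegnerTau_two_one_two,
    divPoint_two_zero_heegnerTau_two_one_two, divPoint_two_one_heegnerTau_two_one_two, ← formJ_eq_kleinJ,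
    ← formJ_eq_kleinJ, ← formJ_eq_kleinJ, ← formJ_eq_kleinJ, formJ_four_one_one, formJ_eight_neg_six_three] at h
  exact h

/-- `H_{−15}(j₂) = 0` for `j₂ = j(τ_{(2,1,2)})`. [cite: Morton2014, p. 84] -/
theorem formJ_two_one_two_isRoot : formJ (2, 1, 2) ^ 2 + 191025 * formJ (2, 1, 2) - 121287375 = 0 := by
  rw [formJ_two_one_two_eq_neg_sub]
  linear_combination formJ_one_one_four_isRoot

/-- **`j(τ_{(3,0,5)}) = 121831425 − 192511·j(τ_{(2,1,2)})`** — the simple root of the fibre over `j₂`.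
[cite: Morton2014, p. 84] -/
theorem formJ_three_zero_five_eq_sub : formJ (3, 0, 5) = 121831425 - 192511 * formJ (2, 1, 2) := by
  refine eq_of_cubic_eq_simple (A := -191025 - formJ (2, 1, 2)) fun x => ?_
  have hA : formJ (1, 1, 4) = -191025 - formJ (2, 1, 2) := by rw [formJ_two_one_two_eq_neg_sub]; ring
  have h1 := fiber_formJ_two_one_two x
  rw [hA] at h1
  have e : (x - formJ (3, 0, 5)) * ((x - (-191025 - formJ (2, 1, 2))) * (x - (-191025 - formJ (2, 1, 2)))) =
      (x - (-191025 - formJ (2, 1, 2))) * ((x - (-191025 - formJ (2, 1, 2))) * (x - formJ (3, 0, 5))) := by ring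
  rw [e, ← h1, fiber_eq_of_root formJ_two_one_two_isRoot x]

/-- **`j(τ_{(3,0,5)}) = (37018076625 − 16554983445√5)/2`**. [cite: Ishii2004, §3 table (row d(R) = −60)] -/
theorem formJ_three_zero_five_eq :
    formJ (3, 0, 5) = (37018076625 - 16554983445 * (√(5 : ℝ) : ℂ)) / 2 := by
  rw [formJ_three_zero_five_eq_sub, formJ_two_one_two_eq]
  ring

/-- Trace: `j(τ_{(1,0,15)}) + j(τ_{(3,0,5)}) = 37018076625`. [cite: Ishii2004, §3 table (row d(R) = −60)] -/
theorem formJ_add_neg_sixty : formJ (1, 0, 15) + formJ (3, 0, 5) = 37018076625 := by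
  rw [formJ_one_zero_fifteen_eq, formJ_three_zero_five_eq]; ring

/-- Norm: `j(τ_{(1,0,15)}) · j(τ_{(3,0,5)}) = 153173312762625 = 53505³`. [cite: Ishii2004, §3 table (row d(R) = −60)] -/
theorem formJ_mul_neg_sixty : formJ (1, 0, 15) * formJ (3, 0, 5) = 153173312762625 := by
  rw [formJ_one_zero_fifteen_eq, formJ_three_zero_five_eq]
  have h5 : ((√(5 : ℝ) : ℝ) : ℂ) ^ 2 = 5 := by
    rw [← Complex.ofReal_pow, Real.sq_sqrt (by norm_num)]; norm_num
  linear_combination (-(16554983445 : ℂ) ^ 2 / 4) * h5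

end ClassPolynomialNegSixty

open ClassPolynomialNegSixty

/-! ### §4 The class polynomial `H_{−60}` -/

/-- **`H_{−60}(X) = X² − 37018076625·X + 153173312762625`**: the class polynomial of the order `ℤ[√−15]`
of discriminant `−60` (reduced forms `(1,0,15)`, `(3,0,5)`), as a kernel theorem about the tree's
`classPolynomial (−60)`. [cite: Ishii2004, §3 table (row d(R) = −60)] -/
theorem classPolynomial_neg_sixty :
    classPolynomial (-60) = X ^ 2 - C (37018076625 : ℂ) * X + C (153173312762625 : ℂ) := by
  have hred : reducedForms (-60) = {((1 : ℤ), (0 : ℤ), (15 : ℤ)), (3, 0, 5)} := by decide +kernel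
  rw [classPolynomial, hred, Finset.prod_pair (by decide)]
  calc (X - C (formJ (1, 0, 15))) * (X - C (formJ (3, 0, 5)))
      = X ^ 2 - C (formJ (1, 0, 15) + formJ (3, 0, 5)) * X + C (formJ (1, 0, 15) * formJ (3, 0, 5)) := by
        rw [C_add, C_mul]; ring
    _ = X ^ 2 - C (37018076625 : ℂ) * X + C (153173312762625 : ℂ) := by
        rw [formJ_add_neg_sixty, formJ_mul_neg_sixty]

/-- `H_{−60}(x) = x² − 37018076625x + 153173312762625` for every `x ∈ ℂ`. [cite: Ishii2004, §3 table (row d(R) = −60)] -/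
theorem classPolynomial_neg_sixty_eval (x : ℂ) :
    (classPolynomial (-60)).eval x = x ^ 2 - 37018076625 * x + 153173312762625 := by
  rw [classPolynomial_neg_sixty]
  simp only [eval_add, eval_sub, eval_mul, eval_pow, eval_X, eval_C]

/-- `H_{−60}` as the product of its explicit linear factors. [cite: Ishii2004, §3 table (row d(R) = −60)] -/
theorem classPolynomial_neg_sixty_eq_mul :
    classPolynomial (-60) =
      (X - C ((37018076625 + 16554983445 * (√(5 : ℝ) : ℂ)) / 2)) *
        (X - C ((37018076625 - 16554983445 * (√(5 : ℝ) : ℂ)) / 2)) := by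
  have hred : reducedForms (-60) = {((1 : ℤ), (0 : ℤ), (15 : ℤ)), (3, 0, 5)} := by decide +kernel
  rw [classPolynomial, hred, Finset.prod_pair (by decide), formJ_one_zero_fifteen_eq, formJ_three_zero_five_eq]

/-- **`H_{−60}(0) = 153173312762625 = 53505³`** (a perfect cube). [cite: Ishii2004, §3 table (row d(R) = −60)] -/
theorem classPolynomial_neg_sixty_eval_zero : (classPolynomial (-60)).eval 0 = 53505 ^ 3 := by
  rw [classPolynomial_neg_sixty_eval]; norm_num

/-- **`H_{−60}(1728) = 89206079340609 = 9444897² = (3³·7²·11²·59)²`** (a perfect square).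
[cite: Ishii2004, §3 table (row d(R) = −60)] -/
theorem classPolynomial_neg_sixty_eval_1728 : (classPolynomial (-60)).eval 1728 = 9444897 ^ 2 := by
  rw [classPolynomial_neg_sixty_eval]; norm_num

/-- `9444897 = 3³·7²·11²·59` and `53505 = 3²·5·29·41`. [cite: Ishii2004, §3 table (row d(R) = −60)] -/
theorem classPolynomial_neg_sixty_values_factored :
    (classPolynomial (-60)).eval 1728 = (3 ^ 3 * 7 ^ 2 * 11 ^ 2 * 59) ^ 2 ∧
      (classPolynomial (-60)).eval 0 = (3 ^ 2 * 5 * 29 * 41) ^ 3 := by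
  rw [classPolynomial_neg_sixty_eval, classPolynomial_neg_sixty_eval]; norm_num

end Literature.NumberTheory.EllipticCurves

end
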